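import Summits.HodgeConjecture.HodgeConjecture.Cruxes.BlochSeedDiscOne.BoxCap
import Summits.HodgeConjecture.HodgeConjecture.Cruxes.BlochSeedDiscOne.ShellThreeFloorB
import Summits.HodgeConjecture.HodgeConjecture.Cruxes.BlochSeedDiscOne.SigmaH

/-!
# ShellGenericPlate — the moment ∕ BOXCAP mass plate at EVERY shell, over an ABSTRACT cell functional, binders DISPLAYED (anomaly g18, v2)

`line stmt-HodgeConjecture-18881 Cruxes/BlochSeedDiscOne/Lines/birth.lean 814a6a70c14e831a stub_rung_pad4_seedAt`
Seat: plan-lens-HodgeAV-anomaly g18 (planner, lens «anomaly», director-hodge req-36; claim-free, evidence-only).  Census row of record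
◇₈ r3 j305149 (bc5-plan g8), ◇₁₀ G₁ j308425 — unchanged: CENSUS-NEUTRAL letter-model arithmetic.  **Nothing here is proved toward HC ∕
HC_CM ∕ HC_AV ∕ H2 ∕ 18881 ∕ 30548**; `Nonex 14 199 8` stays REFUTED as typed; letters ≠ sheaves ≠ SEED.  KERNEL STATEMENTS ONLY — no
`sorry`, no new axiom, no `instance`, no `notation`, no `decide`, no `native_decide`.  Imports only HUB-BUILT modules (`BoxCap` v3,
`ShellThreeFloorB`, `SigmaH`).

## What this file is
Dual g17's shell-3 plate `ShellThreeClosed.shell3_empty_of_binders` closes shell 3 from three displayed binders (B), (Bu), (M2 = every N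
cell hubbed) through the chain (P1) `9·S + 8·HF ≤ 8·M` — (P2)(P3) `S ≥ 24`, `16·S ≤ (S − 8)·HF` (negation g22, `BoxCap` §6) — (P4)
`M ≥ 51` — (P0) `M ≤ 50`.  Of these ONLY (P1) is shell-3-specific (dual derives it from the co-level-`≤ 2` KIND TABLE of `ShellThreeFloorB`).
This file derives (P1) at EVERY shell from a MOMENT LAW of slope `18` for an arbitrary integer cell functional `φ : Cell → ℤ` — the two
properties of `φ` that are used are DISPLAYED as hypotheses:

* (Φax)  `AxisVanishing φ`   — `φ c = 0` on every AXIS cell (`x_f = 0 ∨ y_f = 0` at every slot);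
* (Φ18)  `MomentLaw φ h D`   — `Σ_P m·φ = Σ_N m·φ + 18·(−E_h D)`;

and so are the four binders on the design:

* (M1) `BoxCap.NHubbed h D`        — every supported N cell carries the hub letter `(h; 0, 0)`              [= dual's (M2)];
* (M2) `BoxCap.HubfreePAxis h D`   — every hub-free supported P cell is an AXIS cell                          [⇐ (B)+(Bu) at shell 3];
* (ΦP) `PhiSignP φ h D`            — every supported HUB-BEARING P cell has `φ ≤ 16`;
* (ΦN) `PhiSignN φ D`              — every supported N cell has `0 ≤ φ`.

THE INTENDED INSTANCE is `φ := NineEighthsIdentity.phi16Z` (= `16·Φ′`, anomaly g17, tree module accepted 2026-08-31 06:33Z): there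
(Φax) is `NineEighthsIdentity.phi16Z_axis` and (Φ18) is `NineEighthsIdentity.pmoment_eq hD h1` (the NINE-EIGHTHS IDENTITY, every height,
every shell, hypotheses `D.OnAlphabet h`, `D.A1` only), so for `φ = phi16Z` the two functional hypotheses DISAPPEAR and (ΦP)∕(ΦN) are the
Φ′-SIGN LAWS of the memo (`K_s-P := {H-bearing shapes with 16Φ′ > 16}` unsupported on P, `K_s-N := {16Φ′ < 0}` unsupported on N).  That
three-line instantiation is the companion file `ShellGenericPlateNE.lean` (lands when the hub has built `NineEighthsIdentity`; this file
does not import it so that it elaborates on the farm today).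

THEOREMS (all `φ`-generic): `pointwise_P`; `nine_S_add_eight_HF_le` ((P1) at every shell: (M1)(M2)(ΦP)(ΦN)(Φax)(Φ18) ⟹
`9·S + 8·HF ≤ 8·M`, `S = Σ_P m·ρ_h = −E_h`, `HF = Σ_P m·[ρ_h > 0]`, `M = Σ_P m`); `fiftyone_le` ((P4), integer arithmetic, = dual's
`ShellThreeClosed.fiftyone_le`, re-proved here in five lines because that module's hub build is pending — cite dual's); `pmass_ge_51_of_phiSign`
(+ (A1), `μ ≠ 0` ⟹ `51 ≤ M` via negation's (P2)(P3)); `pmass_le_fifty` ((P0) from the budget clause of any `σ ≥ 28·copies` and PortHall₈ —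
= dual's `ShellThreeClosed.pmass_le_fifty`, same remark); `shell_empty_of_phiSign` ∕ `_sigmaH` ∕ `shell_empty_of_binders` (⟹ `False`);
§4 the TOLERANT plate `pmass_ge_51_of_phiSignT` ∕ `shell_empty_of_phiSignT` ((ΦP) weakened to `φ ≤ T`, any `0 ≤ T ≤ 20`, given the
displayed pen laws (S3) `32 ≤ S` and `8 ∣ S`; `fiftyone_le_tol`; at `T = 21` the arithmetic fails at `S = 32`, so `20` is the exact slack).
No ring ∕ shell hypothesis anywhere: the shell enters only through WHO discharges (M1), (M2), (ΦP), (ΦN).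

## What the mass LPs say about the binders (memo `SHELL-CORE-v1-anomaly-g17.md` v1.3.1; bus RESULT-1 of g18 l.14619)
With all four binders the exact type-mass LP floor is `65 = 9·40∕8 + 20` at `s = 4` and `s = 5` (= this plate's arithmetic at `S = 40`).
(ΦP)∕(ΦN) need not hold in full: at `s = 4` the shapes with `16 < 16Φ′ ≤ 20` may live (floor 61.48), at `s = 5` too (56.35) — §4.  (M2) is
load-bearing: priced instead by negation's general box laws (`BoxCap` §7) plus clause-2, the (M1₄)-only READING-β floor on extremal's
run-1+1c dead world is `405∕8 = 50.625 @ S = 72` (strict by `5∕8`), and from `s = 6` on the hub-free shapes `u³X` with `X` near-diagonal of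
co-level `≥ 6` defeat every mass law in hand at large `S`: the door ∕ a family lemma must supply (M2) there.
-/

set_option linter.dupNamespace false
set_option autoImplicit false

namespace Summit.HodgeConjecture.HodgeConjecture.Cruxes.BlochSeedDiscOne.ShellGenericPlate

open Summit.HodgeConjecture.HodgeConjecture.Cruxes.BlochSeedDiscOne.DepthBoundA4
open Summit.HodgeConjecture.HodgeConjecture.Cruxes.BlochSeedDiscOne.RuleDPlate (HallPlusUp BudgetClause eight_le_rank_of_hallPlusUp)
open Summit.HodgeConjecture.HodgeConjecture.Cruxes.BlochSeedDiscOne.RingFourEmpty (linZ_add linZ_smul linZ_mono)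
open Summit.HodgeConjecture.HodgeConjecture.Cruxes.BlochSeedDiscOne.RingTwoMassLaw.ClassLaw (E)
open Summit.HodgeConjecture.HodgeConjecture.Cruxes.BlochSeedDiscOne.BoxIdentity (rho A1e a1e_of_a1)
open Summit.HodgeConjecture.HodgeConjecture.Cruxes.BlochSeedDiscOne.BoxCap
  (NHubbed AxisCell HubfreePAxis hfInd pmass_ge_24 sixteen_pmass_le rho_eq_zero_of_hub sigma_eq_neg_pmass)
open Summit.HodgeConjecture.HodgeConjecture.Cruxes.BlochSeedDiscOne.ShellThreeFloorB (linZ_one_eq_massP)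
open Summit.HodgeConjecture.HodgeConjecture.Cruxes.BlochSeedDiscOne.SigmaH (sigmaH diag_le_sigmaH)

/-! ## §0 The two displayed properties of the functional -/

/-- **(Φax)** `φ` vanishes on AXIS cells (for `φ = phi16Z`: `NineEighthsIdentity.phi16Z_axis`). -/
def AxisVanishing (φ : Cell → ℤ) : Prop := ∀ c : Cell, AxisCell c → φ c = 0

/-- **(Φ18)** the MOMENT LAW of slope `18`: `Σ_P m·φ = Σ_N m·φ + 18·(−E_h)` (for `φ = phi16Z`: `NineEighthsIdentity.pmoment_eq`, the
nine-eighths identity under `D.OnAlphabet h`, `D.A1`). -/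
def MomentLaw (φ : Cell → ℤ) (h : ℤ) (D : Design) : Prop := linZ D.P φ = linZ D.N φ + 18 * (-(E h D))

/-- under (M1) the energy is minus the P dep-mass: `−E_h = Σ_P m·ρ_h` (`E = Σ`, `dep = ρ` definitionally; `BoxCap.sigma_eq_neg_pmass`). -/
theorem negE_eq_pmass (h : ℤ) (D : Design) (hM1 : NHubbed h D) : -(E h D) = linZ D.P (rho h) := by
  rw [show E h D = BoxIdentity.Sigma h D from rfl, sigma_eq_neg_pmass h D hM1, neg_neg]

/-! ## §1 The two sign binders -/

/-- **(ΦP)** every supported hub-bearing P cell has `φ ≤ 16`. -/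
def PhiSignP (φ : Cell → ℤ) (h : ℤ) (D : Design) : Prop :=
  ∀ cm ∈ D.P, 0 < cm.2 → (∃ f : Fin 4, cm.1 f = Letter.hub h) → φ cm.1 ≤ 16

/-- **(ΦN)** every supported N cell has `0 ≤ φ`. -/
def PhiSignN (φ : Cell → ℤ) (D : Design) : Prop := ∀ cm ∈ D.N, 0 < cm.2 → 0 ≤ φ cm.1

/-- pointwise form of the P side under (M2) + (ΦP) + (Φax): `φ(c) + 16·[ρ_h(c) > 0] ≤ 16` on every supported P cell
(hub-bearing: `φ ≤ 16`, indicator `0`; hub-free: axis, `φ = 0`, indicator `≤ 1`). -/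
theorem pointwise_P {φ : Cell → ℤ} {h : ℤ} {D : Design} (hax : AxisVanishing φ) (hM2 : HubfreePAxis h D) (hP : PhiSignP φ h D) :
    ∀ cm ∈ D.P, 0 < cm.2 → φ cm.1 + 16 * hfInd h cm.1 ≤ 16 := by
  intro cm hcm hpos
  obtain ⟨c, m⟩ := cm
  have hc : c ∈ D.suppP := (mem_suppP_iff D c).2 ⟨m, hcm, hpos⟩
  show φ c + 16 * hfInd h c ≤ 16
  by_cases hh : ∃ f : Fin 4, c f = Letter.hub h
  · obtain ⟨f, hf⟩ := hh
    have h0 : hfInd h c = 0 := by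
      unfold hfInd
      rw [rho_eq_zero_of_hub h c f hf]
      simp
    have hle : φ c ≤ 16 := hP (c, m) hcm hpos ⟨f, hf⟩
    rw [h0]
    linarith
  · have hnh : ∀ f : Fin 4, c f ≠ Letter.hub h := fun f hf => hh ⟨f, hf⟩
    have hz : φ c = 0 := hax c (hM2 c hc hnh)
    have h1 : hfInd h c ≤ 1 := by
      unfold hfInd
      split_ifs <;> norm_num
    rw [hz]
    linarith

/-! ## §2 (P1) at every shell -/

/-- **(P1) AT EVERY SHELL.**  (M1) + (M2) + (ΦP) + (ΦN) + (Φax) + (Φ18) give `9·S + 8·HF ≤ 8·M`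
(`S = Σ_P m·ρ_h`, `HF = Σ_P m·[ρ_h > 0]`, `M = Σ_P m`).  No ring bound, no RULE D, no `Disj`, no alphabet clause. -/
theorem nine_S_add_eight_HF_le {φ : Cell → ℤ} {h : ℤ} {D : Design} (hax : AxisVanishing φ) (h18 : MomentLaw φ h D)
    (hM1 : NHubbed h D) (hM2 : HubfreePAxis h D) (hP : PhiSignP φ h D) (hN : PhiSignN φ D) :
    9 * linZ D.P (rho h) + 8 * linZ D.P (hfInd h) ≤ 8 * (((D.P.map Prod.snd).sum : ℕ) : ℤ) := by
  have hpt := pointwise_P hax hM2 hP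
  have e16 : linZ D.P (fun _ => (16 : ℤ)) = 16 * (((D.P.map Prod.snd).sum : ℕ) : ℤ) := by
    rw [← linZ_one_eq_massP D, ← linZ_smul]
    simp only [mul_one]
  have hm := linZ_mono D.P (fun c => φ c + 16 * hfInd h c) (fun _ => (16 : ℤ)) hpt
  rw [linZ_add, linZ_smul, e16] at hm
  have hN0 : 0 ≤ linZ D.N φ := linZ_nonneg D.N φ hN
  have hE := negE_eq_pmass h D hM1
  unfold MomentLaw at h18
  rw [hE] at h18
  linarith

/-! ## §3 The plate at every shell -/

/-- **(P4)** the integer arithmetic close: `24 ≤ S`, `9·S + 8·HF ≤ 8·M`, `16·S ≤ (S − 8)·HF` ⟹ `51 ≤ M`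
(= dual g17's `ShellThreeClosed.fiftyone_le`; re-proved here only because that module's hub build is pending — cite dual's). -/
theorem fiftyone_le {S HF M : ℤ} (h24 : 24 ≤ S) (h9 : 9 * S + 8 * HF ≤ 8 * M) (h16 : 16 * S ≤ (S - 8) * HF) : 51 ≤ M := by
  have hHF : 17 ≤ HF := by
    by_contra hc
    simp only [not_le] at hc
    nlinarith [mul_nonneg (show (0 : ℤ) ≤ S - 8 by omega) (show (0 : ℤ) ≤ 16 - HF by omega)]
  by_contra hM
  simp only [not_le] at hM
  have hS : S ≤ 29 := by omega
  interval_cases S <;> omega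

/-- **THE P-MASS FLOOR AT EVERY SHELL (budget-free, Hall-free, door-free).**  Clause (A1) on the height-`h` alphabet, `μ ≠ 0`, the four
displayed binders (M1), (M2), (ΦP), (ΦN) and the two displayed properties (Φax), (Φ18) of `φ` ⟹ `51 ≤ Σ_P m`
((P1) here; (P2)(P3) = negation g22's `BoxCap.pmass_ge_24`, `BoxCap.sixteen_pmass_le`; (P4) `fiftyone_le`). -/
theorem pmass_ge_51_of_phiSign {φ : Cell → ℤ} {h : ℤ} {D : Design} (hax : AxisVanishing φ) (h18 : MomentLaw φ h D)
    (hM1 : NHubbed h D) (hM2 : HubfreePAxis h D) (hP : PhiSignP φ h D) (hN : PhiSignN φ D)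
    (hD : D.OnAlphabet h) (h1 : D.A1) (hμ : D.mu ≠ 0) :
    51 ≤ (((D.P.map Prod.snd).sum : ℕ) : ℤ) := by
  have hA : A1e D := a1e_of_a1 D h1
  have h24 := pmass_ge_24 h D hD hA hμ hM1 hM2
  have h16 := sixteen_pmass_le h D hD hA hμ hM1 hM2
  have h9 := nine_S_add_eight_HF_le hax h18 hM1 hM2 hP hN
  exact fiftyone_le h24 h9 h16

/-- **(P0)** under the budget clause of any `σ ≥ 28·copies` (so `copies + rank ≤ 116`) and PortHall₈ (`rank ≥ 8` on a non-empty P side):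
`Σ_P m ≤ 50` (= dual g17's `ShellThreeClosed.pmass_le_fifty`; re-proved here from `RuleDPlate.eight_le_rank_of_hallPlusUp` only because
that module's hub build is pending — cite dual's). -/
theorem pmass_le_fifty (σ : Design → ℤ) {D : Design} (hσ : 28 * (D.copies : ℤ) ≤ σ D) (hb : BudgetClause σ 0 D)
    (hp : HallPlusUp D 8) : (((D.P.map Prod.snd).sum : ℕ) : ℤ) ≤ 50 := by
  have h116 : (D.copies : ℤ) + D.rank ≤ 116 := by
    unfold BudgetClause at hb
    omega
  have hc : (D.copies : ℤ) = (((D.N.map Prod.snd).sum : ℕ) : ℤ) + (((D.P.map Prod.snd).sum : ℕ) : ℤ) := by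
    simp only [Design.copies, Nat.cast_add]
  have hr : D.rank = (((D.N.map Prod.snd).sum : ℕ) : ℤ) - (((D.P.map Prod.snd).sum : ℕ) : ℤ) := rfl
  by_cases hpos : 0 < (D.P.map Prod.snd).sum
  · have h8 := eight_le_rank_of_hallPlusUp D hp hpos
    omega
  · have h0 : (D.P.map Prod.snd).sum = 0 := by omega
    rw [h0]
    norm_num

/-- **THE PLATE AT EVERY SHELL.**  Clause (A1), PortHall₈, `μ ≠ 0`, the budget clause of any `σ ≥ 28·copies`, the four displayed
binders and the two displayed properties of `φ` ⟹ `False`.  No ring ∕ shell hypothesis: the shell enters only through WHO discharges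
(M1), (M2), (ΦP), (ΦN). -/
theorem shell_empty_of_phiSign {φ : Cell → ℤ} {h : ℤ} (σ : Design → ℤ) {D : Design} (hσ : 28 * (D.copies : ℤ) ≤ σ D)
    (hax : AxisVanishing φ) (h18 : MomentLaw φ h D)
    (hM1 : NHubbed h D) (hM2 : HubfreePAxis h D) (hP : PhiSignP φ h D) (hN : PhiSignN φ D)
    (hD : D.OnAlphabet h) (h1 : D.A1) (hp : HallPlusUp D 8) (hμ : D.mu ≠ 0) (hb : BudgetClause σ 0 D) : False := by
  have h51 := pmass_ge_51_of_phiSign hax h18 hM1 hM2 hP hN hD h1 hμ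
  have h50 := pmass_le_fifty σ hσ hb hp
  omega

/-- the plate in the currency of record `σ_H` (`SigmaH.diag_le_sigmaH : 28·copies ≤ σ_H`). -/
theorem shell_empty_of_phiSign_sigmaH {φ : Cell → ℤ} {h : ℤ} {D : Design} (hax : AxisVanishing φ) (h18 : MomentLaw φ h D)
    (hM1 : NHubbed h D) (hM2 : HubfreePAxis h D) (hP : PhiSignP φ h D) (hN : PhiSignN φ D)
    (hD : D.OnAlphabet h) (h1 : D.A1) (hp : HallPlusUp D 8) (hμ : D.mu ≠ 0) (hb : BudgetClause sigmaH 0 D) : False :=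
  shell_empty_of_phiSign sigmaH (diag_le_sigmaH D) hax h18 hM1 hM2 hP hN hD h1 hp hμ hb

/-- The four displayed binders as one predicate (the summit-facing residual of the mass calculus at every shell, for a given `φ`). -/
def Binders (φ : Cell → ℤ) (h : ℤ) (D : Design) : Prop := NHubbed h D ∧ HubfreePAxis h D ∧ PhiSignP φ h D ∧ PhiSignN φ D

theorem shell_empty_of_binders {φ : Cell → ℤ} {h : ℤ} {D : Design} (hax : AxisVanishing φ) (h18 : MomentLaw φ h D)
    (hB : Binders φ h D) (hD : D.OnAlphabet h) (h1 : D.A1) (hp : HallPlusUp D 8) (hμ : D.mu ≠ 0) (hb : BudgetClause sigmaH 0 D) :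
    False :=
  shell_empty_of_phiSign_sigmaH hax h18 hB.1 hB.2.1 hB.2.2.1 hB.2.2.2 hD h1 hp hμ hb

/-! ## §4 Tolerance: the P-side sign law has slack `16 → 20`, uniformly in the shell

The mass LPs show that hub-bearing P shapes with `16 < 16Φ′ ≤ 20` may stay alive at `s = 4, 5` (floors 61.48 ∕ 56.35).  The kernel form:
with the P-binder weakened to `φ ≤ T` for any `0 ≤ T ≤ 20` the plate still gives `51 ≤ Σ_P m` PROVIDED the balance law (S3) `S ≥ 32` and the
lattice law `8 ∣ S` (negation g22 memo, pen ×3; NOT in kernel — displayed here as hypotheses on `S = Σ_P m·ρ_h`).  At `T = 21` the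
arithmetic fails at `S = 32` (`M = 50, HF = 22, S = 32` satisfies every hypothesis), so `20` is the exact slack. -/

/-- **(ΦP)_T** every supported hub-bearing P cell has `φ ≤ T`;  `PhiSignP φ = PhiSignPT 16 φ`. -/
def PhiSignPT (T : ℤ) (φ : Cell → ℤ) (h : ℤ) (D : Design) : Prop :=
  ∀ cm ∈ D.P, 0 < cm.2 → (∃ f : Fin 4, cm.1 f = Letter.hub h) → φ cm.1 ≤ T

theorem phiSignPT_of_phiSignP {φ : Cell → ℤ} {h : ℤ} {D : Design} (hP : PhiSignP φ h D) : PhiSignPT 16 φ h D :=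
  fun cm hcm hpos hf => hP cm hcm hpos hf

theorem pointwise_PT {T : ℤ} {φ : Cell → ℤ} {h : ℤ} {D : Design} (hT0 : 0 ≤ T) (hax : AxisVanishing φ) (hM2 : HubfreePAxis h D)
    (hP : PhiSignPT T φ h D) : ∀ cm ∈ D.P, 0 < cm.2 → φ cm.1 + T * hfInd h cm.1 ≤ T := by
  intro cm hcm hpos
  obtain ⟨c, m⟩ := cm
  have hc : c ∈ D.suppP := (mem_suppP_iff D c).2 ⟨m, hcm, hpos⟩
  show φ c + T * hfInd h c ≤ T
  by_cases hh : ∃ f : Fin 4, c f = Letter.hub h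
  · obtain ⟨f, hf⟩ := hh
    have h0 : hfInd h c = 0 := by
      unfold hfInd
      rw [rho_eq_zero_of_hub h c f hf]
      simp
    have hle : φ c ≤ T := hP (c, m) hcm hpos ⟨f, hf⟩
    rw [h0, mul_zero, add_zero]
    exact hle
  · have hnh : ∀ f : Fin 4, c f ≠ Letter.hub h := fun f hf => hh ⟨f, hf⟩
    have hz : φ c = 0 := hax c (hM2 c hc hnh)
    rw [hz, zero_add]
    unfold hfInd
    split_ifs
    · rw [mul_one]
    · rw [mul_zero]; exact hT0

/-- the moment budget under (M1)(M2)(ΦP)_T(ΦN)(Φax)(Φ18): `18·S + T·HF ≤ T·M`. -/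
theorem eighteen_S_le {T : ℤ} {φ : Cell → ℤ} {h : ℤ} {D : Design} (hT0 : 0 ≤ T) (hax : AxisVanishing φ) (h18 : MomentLaw φ h D)
    (hM1 : NHubbed h D) (hM2 : HubfreePAxis h D) (hP : PhiSignPT T φ h D) (hN : PhiSignN φ D) :
    18 * linZ D.P (rho h) + T * linZ D.P (hfInd h) ≤ T * (((D.P.map Prod.snd).sum : ℕ) : ℤ) := by
  have hpt := pointwise_PT hT0 hax hM2 hP
  have eT : linZ D.P (fun _ => T) = T * (((D.P.map Prod.snd).sum : ℕ) : ℤ) := by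
    rw [← linZ_one_eq_massP D, ← linZ_smul]
    simp only [mul_one]
  have hm := linZ_mono D.P (fun c => φ c + T * hfInd h c) (fun _ => T) hpt
  rw [linZ_add, linZ_smul, eT] at hm
  have hN0 : 0 ≤ linZ D.N φ := linZ_nonneg D.N φ hN
  have hE := negE_eq_pmass h D hM1
  unfold MomentLaw at h18
  rw [hE] at h18
  linarith

/-- arithmetic close of the tolerant plate: `32 ≤ S`, `8 ∣ S`, `9·S ≤ 10·(M − HF)`, `16·S ≤ (S − 8)·HF` ⟹ `51 ≤ M`. -/
theorem fiftyone_le_tol {S HF M : ℤ} (h32 : 32 ≤ S) (h8 : (8 : ℤ) ∣ S) (h9 : 9 * S ≤ 10 * (M - HF))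
    (h16 : 16 * S ≤ (S - 8) * HF) : 51 ≤ M := by
  have hHF : 17 ≤ HF := by
    by_contra hc
    simp only [not_le] at hc
    nlinarith [mul_nonneg (show (0 : ℤ) ≤ S - 8 by omega) (show (0 : ℤ) ≤ 16 - HF by omega)]
  obtain ⟨k, hk⟩ := h8
  rcases (show S = 32 ∨ S = 40 ∨ 48 ≤ S by omega) with hS | hS | hS
  · subst hS
    omega
  · subst hS
    omega
  · omega

/-- **TOLERANT P-MASS FLOOR AT EVERY SHELL.**  (M1), (M2), (ΦP)_T with `0 ≤ T ≤ 20`, (ΦN), (Φax), (Φ18), clause (A1), `μ ≠ 0`, and the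
displayed pen laws (S3) `32 ≤ S`, `8 ∣ S` ⟹ `51 ≤ Σ_P m`. -/
theorem pmass_ge_51_of_phiSignT {T : ℤ} {φ : Cell → ℤ} {h : ℤ} {D : Design} (hT0 : 0 ≤ T) (hT : T ≤ 20)
    (hax : AxisVanishing φ) (h18 : MomentLaw φ h D)
    (hM1 : NHubbed h D) (hM2 : HubfreePAxis h D) (hP : PhiSignPT T φ h D) (hN : PhiSignN φ D)
    (hD : D.OnAlphabet h) (h1 : D.A1) (hμ : D.mu ≠ 0)
    (h32 : 32 ≤ linZ D.P (rho h)) (h8 : (8 : ℤ) ∣ linZ D.P (rho h)) :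
    51 ≤ (((D.P.map Prod.snd).sum : ℕ) : ℤ) := by
  have hA : A1e D := a1e_of_a1 D h1
  have h16 := sixteen_pmass_le h D hD hA hμ hM1 hM2
  have hb := eighteen_S_le hT0 hax h18 hM1 hM2 hP hN
  set S := linZ D.P (rho h) with hSdef
  set HF := linZ D.P (hfInd h) with hHFdef
  set M := (((D.P.map Prod.snd).sum : ℕ) : ℤ) with hMdef
  have hMF : 0 < M - HF := by
    by_contra hc
    simp only [not_lt] at hc
    nlinarith
  have h20 : T * (M - HF) ≤ 20 * (M - HF) := mul_le_mul_of_nonneg_right hT (le_of_lt hMF)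
  have h9 : 9 * S ≤ 10 * (M - HF) := by nlinarith
  exact fiftyone_le_tol h32 h8 h9 h16

/-- the tolerant plate with the budget: `False`. -/
theorem shell_empty_of_phiSignT {T : ℤ} {φ : Cell → ℤ} {h : ℤ} (σ : Design → ℤ) {D : Design} (hσ : 28 * (D.copies : ℤ) ≤ σ D)
    (hT0 : 0 ≤ T) (hT : T ≤ 20) (hax : AxisVanishing φ) (h18 : MomentLaw φ h D)
    (hM1 : NHubbed h D) (hM2 : HubfreePAxis h D) (hP : PhiSignPT T φ h D) (hN : PhiSignN φ D)
    (hD : D.OnAlphabet h) (h1 : D.A1) (hp : HallPlusUp D 8) (hμ : D.mu ≠ 0) (hb : BudgetClause σ 0 D)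
    (h32 : 32 ≤ linZ D.P (rho h)) (h8 : (8 : ℤ) ∣ linZ D.P (rho h)) : False := by
  have h51 := pmass_ge_51_of_phiSignT hT0 hT hax h18 hM1 hM2 hP hN hD h1 hμ h32 h8
  have h50 := pmass_le_fifty σ hσ hb hp
  omega

/-! ## §5 Sharpness of the tolerance: `T = 21` admits the integer point `(S, HF, M) = (32, 22, 50)` -/

/-- every arithmetic hypothesis of `fiftyone_le_tol` with `10` replaced by the `T = 21` budget `18·S ≤ 21·(M − HF)` holds at
`S = 32, HF = 22, M = 50` — so the slack `T ≤ 20` of §4 is exact at the level of the arithmetic. -/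
theorem tol_21_fails : (32 : ℤ) ≤ 32 ∧ (8 : ℤ) ∣ 32 ∧ 18 * (32 : ℤ) ≤ 21 * (50 - 22) ∧ 16 * (32 : ℤ) ≤ (32 - 8) * 22 ∧ ¬ (51 : ℤ) ≤ 50 := by
  refine ⟨le_refl _, ⟨4, by norm_num⟩, by norm_num, by norm_num, by norm_num⟩

end Summit.HodgeConjecture.HodgeConjecture.Cruxes.BlochSeedDiscOne.ShellGenericPlate
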